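import Summits.Ventures.HodgeRepro2.T5RecordSphericalSpectrumInertToyConcrete
import Summits.Ventures.HodgeRepro2.T5RecordLatticeModelSeven

/-!
# Joint consistency on the second toy instance: `ℚ(i)` at the inert place `(3)`

Tier-5 support N3 / §G-N4.2 (seat p3, gen 87). File 349 (`T5RecordSevenThreeJoint`) exhibits, in ONE theorem, the
hypotheses of the lane's two capstone statements — the lattice-model data of §N3.10.3 (file 331) and the unramified
spectrum of the record's pair (file 344) — instantiated at once on the field of record `ℚ(ζ₇)` at `(3)`. This file
does the same on the lane's second toy field `L = ℚ(ζ₄) = ℚ(i)` (any fourth cyclotomic extension of `ℚ`) at the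
inert place `(3)` of `ℚ(i)⁺ = ℚ` (file 238's `vThreePlus`, `N(v) = 3`), above seat p8's place `(3)` of `ℚ`, with every
datum explicit: `M = diag(1, 1, −1)` (file 348's `record_lattice_model_four_three`), the datum
`(θ, y) = (−1, ζ₄)` and the generators from file 235 (files 345 / 346):

* **`joint_four_three`** — under the section instances `[NumberField L] [IsCMField L]`: (i) an additive character
  `ψ : ℚ₃ → S¹` of conductor exponent `0` with `n(ψ ∘ Tr) = 0` exists, and for every such `ψ` and every `w ∣ (3)`:
  `e = 1`, `n(ψ_w) = 0`, `𝒪_w` is `ψ_w`-self-dual, `𝒪_w³` is `ψ_w`-self-dual for `diag(1, 1, −1)` under any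
  integrality-preserving star and so is the split pair; AND (ii) generators `l` of `𝓞_{ℚ(i)}` over `𝓞_{ℚ(i)⁺}` exist
  with `u₀`, an isomorphism `Φ : U(J₃(u₀)) ≃* U(1 ⊗ H₀)` matching the hyperspecial subgroups, a star-fixed
  uniformiser `ϖ'`, such that every irreducible `K_{(3)}`-finite representation of `U(1 ⊗ H₀)` with non-zero
  finite-dimensional `K_{(3)}`-invariants is `≅ (inertSphericalQuot (α · (3²)⁻¹)) ∘ Φ⁻¹` for some `α ≠ 0`;
* **`joint_four_three_concrete`** — the same with the number-field and CM-field structures of `ℚ(ζ₄)` supplied inside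
  the statement (file 238's `numberField L`, p8's `isCMField_four L`): no hypothesis on `L` remains beyond
  `IsCyclotomicExtension {4} ℚ L`.

The proofs are the pair of files 348 and 345 (resp. 346) at `L`; nothing is re-proved. With file 349 the joint
consistency of README §10.5 (ii)(d) is kernel on BOTH toy fields of the lane (`N(v) = 27` and `N(v) = 3`). §8(d):
uses an L-value-free non-vanishing device: NO.
-/

open Matrix NumberField NumberField.IsCMField IsDedekindDomain IsDedekindDomain.HeightOneSpectrum Module
  MulAction
open scoped TensorProduct Pointwise
open Summit.Ventures.HodgeRepro2.T5UnitaryGroupForm Summit.Ventures.HodgeRepro2.T5UnitaryHeckeAdjoint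
  Summit.Ventures.HodgeRepro2.T5HeckePermutationModule Summit.Ventures.HodgeRepro2.LevelPositivity
  Summit.Ventures.HodgeRepro2.T5LevelIdempotent Summit.Ventures.HodgeRepro2.T5StarOfInvolution
  Summit.Ventures.HodgeRepro2.T5FinitePlaceCM Summit.Ventures.HodgeRepro2.T5NonSplitPlaceUnitaryGroup
  Summit.Ventures.HodgeRepro2.T5RecordHyperspecial Summit.Ventures.HodgeRepro2.T5GlobalLatticeAlmostAll
  Summit.Ventures.HodgeRepro2.T5HermitianThreeElements Summit.Ventures.HodgeRepro2.T5GaloisCartanThree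
  Summit.Ventures.HodgeRepro2.T5InertDegreeGalois Summit.Ventures.HodgeRepro2.T5InertPlaceCompletion
  Summit.Ventures.HodgeRepro2.T5InertDegreeAdicCompletion Summit.Ventures.HodgeRepro2.T5InertSatakeTransform
  Summit.Ventures.HodgeRepro2.T5InertSatakeTransformCompletion Summit.Ventures.HodgeRepro2.T5InertUnipotentResidue
  Summit.Ventures.HodgeRepro2.T5InertSphericalSubquotient Summit.Ventures.HodgeRepro2.T5RecordSatakeCell
  Summit.Ventures.HodgeRepro2.T5SplitPlaceUnitaryGroup Summit.Ventures.HodgeRepro2.T5FinitePlaceNormIndex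
  Summit.Ventures.HodgeRepro2.T5HermitianLocalIsotropyN3 Summit.Ventures.HodgeRepro2.T5FinitePlaceSplitClassification
  Summit.Ventures.HodgeRepro2.T5InertDegreeCompletion Summit.Ventures.HodgeRepro2.T5InertPlaceCompletionCells
  Summit.Ventures.HodgeRepro2.T5RecordSatake Summit.Ventures.HodgeRepro2.T5CartanCellsDistinct
  Summit.Ventures.HodgeRepro2.T5RecordSatakeInert Summit.Ventures.HodgeRepro2.T5InertGlobalPrime
  Summit.Ventures.HodgeRepro2.T5CMFieldSquareDatum Summit.Ventures.HodgeRepro2.T5RecordSatakeDegree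
  Summit.Ventures.HodgeRepro2.T5RecordSatakeDegreeIntrinsic Summit.Ventures.HodgeRepro2.T5RecordSphericalSpectrum
  Summit.Ventures.HodgeRepro2.T5RecordSphericalSpectrumIntrinsic Summit.Ventures.HodgeRepro2.T5RecordSatakeToy
  Summit.Ventures.HodgeRepro2.T5RecordSatakeInertToy Summit.Ventures.HodgeRepro2.T5RecordSatakeInertToyDegree
  Summit.Ventures.HodgeRepro2.T5CMCensusToy Summit.Ventures.HodgeRepro2.T5RecordSphericalSpectrumInertToy
  Summit.Ventures.HodgeRepro2.T5RecordSphericalSpectrumInertToyConcrete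
  Summit.Ventures.HodgeRepro2.T5AdditiveConductor Summit.Ventures.HodgeRepro2.T5UnitaryGroupIsometry
  Summit.Ventures.HodgeRepro2.T5ConductorDualLattice Summit.Ventures.HodgeRepro2.T5ConductorDualLatticeSplit
  Summit.Ventures.HodgeRepro2.T5SplitHermitianClass Summit.Ventures.HodgeRepro2.T5RecordLatticeModelSeven

namespace Summit.Ventures.HodgeRepro2.T5RecordFourThreeJoint

universe uV

section SectionInstances

variable (L : Type*) [Field L] [CharZero L] [IsCyclotomicExtension {2 ^ 2} ℚ L] [NumberField L] [IsCMField L]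
variable (k : Type*) [Field k] [CharZero k] [IsAlgClosed k]

/-- **JOINT CONSISTENCY ON `ℚ(i)` AT `(3)`**: the lattice-model data of §N3.10.3 for `M = diag(1, 1, −1)` (file 348)
AND the unramified spectrum of the record's pair with the explicit datum `(−1, ζ₄)` and the generators supplied
(file 345), at the same place `vThreePlus L` over p8's `vThree`, for any algebraically closed field `k` of
characteristic `0`. -/
theorem joint_four_three :
      ((∃ ψ : AddChar ((T5InertPrimeToy.vThree).adicCompletion ℚ) Circle, Continuous ψ ∧ (∃ y, ψ y ≠ 1) ∧
        conductorExp ψ (Valued.v : Valuation ((T5InertPrimeToy.vThree).adicCompletion ℚ) (WithZero (Multiplicative ℤ))) = 0 ∧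
        conductorExp (ψ.compAddMonoidHom
          (Algebra.trace ((T5InertPrimeToy.vThree).adicCompletion ℚ) ((vThreePlus L).adicCompletion (maximalRealSubfield L))).toAddMonoidHom)
          (Valued.v : Valuation ((vThreePlus L).adicCompletion (maximalRealSubfield L)) (WithZero (Multiplicative ℤ))) = 0) ∧
      ∀ (ψ : AddChar ((T5InertPrimeToy.vThree).adicCompletion ℚ) Circle), Continuous ψ → (∃ y, ψ y ≠ 1) →
        conductorExp ψ (Valued.v : Valuation ((T5InertPrimeToy.vThree).adicCompletion ℚ) (WithZero (Multiplicative ℤ))) = 0 →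
        ∀ (w : HeightOneSpectrum (𝓞 L)) [w.asIdeal.LiesOver (vThreePlus L).asIdeal],
          (vThreePlus L).asIdeal.ramificationIdx' w.asIdeal = 1 ∧
          conductorExp (recordChar L (T5InertPrimeToy.vThree) (vThreePlus L) w ψ)
            (Valued.v : Valuation (w.adicCompletion L) (WithZero (Multiplicative ℤ))) = 0 ∧
          (∀ x : w.adicCompletion L,
            (∀ y : w.adicCompletion L, Valued.v y ≤ 1 → recordChar L (T5InertPrimeToy.vThree) (vThreePlus L) w ψ (x * y) = 1) ↔ Valued.v x ≤ 1) ∧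
          (∀ [StarRing (w.adicCompletion L)],
            (∀ z : w.adicCompletion L, IsLocalization.IsInteger (w.adicCompletionIntegers L) z →
              IsLocalization.IsInteger (w.adicCompletionIntegers L) (star z)) →
            ∀ x : Fin 3 → w.adicCompletion L,
              (∀ y ∈ stdLattice (w.adicCompletionIntegers L),
                recordChar L (T5InertPrimeToy.vThree) (vThreePlus L) w ψ
                  (sesqForm (((algebraMap (𝓞 L) L).mapMatrix (Matrix.diagonal ![1, 1, -1])).map (algebraMap L (w.adicCompletion L))) x y) = 1) ↔
                x ∈ stdLattice (w.adicCompletionIntegers L)) ∧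
          (letI := swapStarRing (w.adicCompletion L)
            ∀ x : Fin 3 → w.adicCompletion L × w.adicCompletion L,
              (∀ y : Fin 3 → w.adicCompletion L × w.adicCompletion L,
                (∀ i, Valued.v (y i).1 ≤ 1 ∧ Valued.v (y i).2 ≤ 1) →
                recordChar L (T5InertPrimeToy.vThree) (vThreePlus L) w ψ
                    (sesqForm (pairMatrix (((algebraMap (𝓞 L) L).mapMatrix (Matrix.diagonal ![1, 1, -1])).map (algebraMap L (w.adicCompletion L)))
                      (((algebraMap (𝓞 L) L).mapMatrix (Matrix.diagonal ![1, 1, -1])).map (algebraMap L (w.adicCompletion L)))ᵀ) x y).1 *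
                  recordChar L (T5InertPrimeToy.vThree) (vThreePlus L) w ψ
                    (sesqForm (pairMatrix (((algebraMap (𝓞 L) L).mapMatrix (Matrix.diagonal ![1, 1, -1])).map (algebraMap L (w.adicCompletion L)))
                      (((algebraMap (𝓞 L) L).mapMatrix (Matrix.diagonal ![1, 1, -1])).map (algebraMap L (w.adicCompletion L)))ᵀ) x y).2 = 1) ↔
                ∀ i, Valued.v (x i).1 ≤ 1 ∧ Valued.v (x i).2 ≤ 1)) ∧
      (∃ (r : ℕ) (l : Fin r → 𝓞 L), Submodule.span (𝓞 (maximalRealSubfield L)) (Set.range l) = ⊤ ∧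
        (letI := tensorStarRing L (vThreePlus L)
        letI := starRingOfQuadratic (finrank_eq_two L (vThreePlus L) (T5InertPrimeToy.wThree L) (neg_one_eq_zeta_sq L) (complexConj_zeta_ne L)
            (not_isSquare_of_staysPrime L (vThreePlus L) (T5InertPrimeToy.wThree L) (neg_one_eq_zeta_sq L) (complexConj_zeta_ne L) (map_vThreePlus L)))
          (localConj (vThreePlus L) (T5InertPrimeToy.wThree L) (neg_one_eq_zeta_sq L).symm (span_pair_eq_top L (complexConj_zeta_ne L))
            (not_isSquare_of_staysPrime L (vThreePlus L) (T5InertPrimeToy.wThree L) (neg_one_eq_zeta_sq L) (complexConj_zeta_ne L) (map_vThreePlus L))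
            (complexConj L))
          (localConj_ne_one (vThreePlus L) (T5InertPrimeToy.wThree L) (neg_one_eq_zeta_sq L).symm (span_pair_eq_top L (complexConj_zeta_ne L))
            (not_isSquare_of_staysPrime L (vThreePlus L) (T5InertPrimeToy.wThree L) (neg_one_eq_zeta_sq L) (complexConj_zeta_ne L) (map_vThreePlus L))
            (complexConj L) (complexConj_apply_eq_neg L (neg_one_eq_zeta_sq L) (complexConj_zeta_ne L)))
        haveI := isDiscreteValuationRing_integralClosure_adicCompletion (vThreePlus L) (T5InertPrimeToy.wThree L)
        haveI := finite_residueField_integralClosure_adicCompletion (vThreePlus L) (T5InertPrimeToy.wThree L)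
        haveI : IsFractionRing (integralClosure ((vThreePlus L).adicCompletionIntegers (maximalRealSubfield L))
            ((T5InertPrimeToy.wThree L).adicCompletion L)) ((T5InertPrimeToy.wThree L).adicCompletion L) :=
          integralClosure.isFractionRing_of_finite_extension ((vThreePlus L).adicCompletion (maximalRealSubfield L))
            ((T5InertPrimeToy.wThree L).adicCompletion L)
        ∃ (u₀ : ((vThreePlus L).adicCompletionIntegers (maximalRealSubfield L))ˣ)
          (Φ : ↥(formUnitaryGroup (J3 (algebraMap ((vThreePlus L).adicCompletionIntegers (maximalRealSubfield L))
            ((T5InertPrimeToy.wThree L).adicCompletion L)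
            (u₀ : (vThreePlus L).adicCompletionIntegers (maximalRealSubfield L))))) ≃*
            ↥(formUnitaryGroup (tensorGram L (vThreePlus L) (gramToy L))))
          (ϖ' : integralClosure ((vThreePlus L).adicCompletionIntegers (maximalRealSubfield L))
            ((T5InertPrimeToy.wThree L).adicCompletion L))
          (hϖ' : Irreducible ϖ')
          (hs' : star (algebraMap (integralClosure ((vThreePlus L).adicCompletionIntegers (maximalRealSubfield L))
            ((T5InertPrimeToy.wThree L).adicCompletion L)) ((T5InertPrimeToy.wThree L).adicCompletion L) ϖ') =
              algebraMap (integralClosure ((vThreePlus L).adicCompletionIntegers (maximalRealSubfield L))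
                ((T5InertPrimeToy.wThree L).adicCompletion L)) ((T5InertPrimeToy.wThree L).adicCompletion L) ϖ'),
          (∀ g, g ∈ hyperspecialSubgroup
              (integralClosure ((vThreePlus L).adicCompletionIntegers (maximalRealSubfield L))
                ((T5InertPrimeToy.wThree L).adicCompletion L))
              (J3 (algebraMap ((vThreePlus L).adicCompletionIntegers (maximalRealSubfield L))
                ((T5InertPrimeToy.wThree L).adicCompletion L)
                (u₀ : (vThreePlus L).adicCompletionIntegers (maximalRealSubfield L)))) ↔
              Φ g ∈ recordHyperspecial L (vThreePlus L) l (gramToy L)) ∧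
          ∀ {V : Type uV} [AddCommGroup V] [Module k V]
            (ρ : Representation k (↥(formUnitaryGroup (tensorGram L (vThreePlus L) (gramToy L)))) V) [ρ.IsIrreducible],
            KFinite ρ (recordHyperspecial L (vThreePlus L) l (gramToy L)) →
            ∀ [FiniteDimensional k (invariants ρ (recordHyperspecial L (vThreePlus L) l (gramToy L)))],
            invariants ρ (recordHyperspecial L (vThreePlus L) l (gramToy L)) ≠ ⊥ →
            ∃ α : k, α ≠ 0 ∧ Nonempty (ρ.Equiv (comp Φ.symm
              (inertSphericalQuot
                (hstar_of_star_eq (localConj (vThreePlus L) (T5InertPrimeToy.wThree L) (neg_one_eq_zeta_sq L).symm (span_pair_eq_top L (complexConj_zeta_ne L))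
                  (not_isSquare_of_staysPrime L (vThreePlus L) (T5InertPrimeToy.wThree L) (neg_one_eq_zeta_sq L) (complexConj_zeta_ne L) (map_vThreePlus L))
                  (complexConj L))
                  (fun x => by
                    rw [star_p8_eq_star L (vThreePlus L) (T5InertPrimeToy.wThree L) (neg_one_eq_zeta_sq L) (complexConj_zeta_ne L)
                      (not_isSquare_of_staysPrime L (vThreePlus L) (T5InertPrimeToy.wThree L) (neg_one_eq_zeta_sq L) (complexConj_zeta_ne L)
                        (map_vThreePlus L))]
                    rfl))
                (algebraMap ((vThreePlus L).adicCompletionIntegers (maximalRealSubfield L))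
                  ((T5InertPrimeToy.wThree L).adicCompletion L)
                  (u₀ : (vThreePlus L).adicCompletionIntegers (maximalRealSubfield L)))
                (star_algebraMap_of_star_eq (localConj (vThreePlus L) (T5InertPrimeToy.wThree L) (neg_one_eq_zeta_sq L).symm
                  (span_pair_eq_top L (complexConj_zeta_ne L))
                  (not_isSquare_of_staysPrime L (vThreePlus L) (T5InertPrimeToy.wThree L) (neg_one_eq_zeta_sq L) (complexConj_zeta_ne L) (map_vThreePlus L))
                  (complexConj L))
                  (fun x => by
                    rw [star_p8_eq_star L (vThreePlus L) (T5InertPrimeToy.wThree L) (neg_one_eq_zeta_sq L) (complexConj_zeta_ne L)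
                      (not_isSquare_of_staysPrime L (vThreePlus L) (T5InertPrimeToy.wThree L) (neg_one_eq_zeta_sq L) (complexConj_zeta_ne L)
                        (map_vThreePlus L))]
                    rfl)
                  (u₀ : (vThreePlus L).adicCompletionIntegers (maximalRealSubfield L)))
                (algebraMap_unit_ne_zero (F := (vThreePlus L).adicCompletion (maximalRealSubfield L)) u₀)
                (isInteger_algebraMap (u₀ : (vThreePlus L).adicCompletionIntegers (maximalRealSubfield L)))
                (isInteger_algebraMap_unit_inv u₀) hϖ' hs' k (α * ((3 : k) ^ 2)⁻¹)))))) :=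
  ⟨record_lattice_model_four_three L (Matrix.diagonal ![1, 1, -1]) (isUnit_det_diagonal L),
    exists_generators_and_mulEquiv_forall_nonempty_equiv_inertSphericalQuot_record_three_zeta L k⟩

end SectionInstances

section Concrete

variable (L : Type*) [Field L] [CharZero L] [IsCyclotomicExtension {2 ^ 2} ℚ L]
variable (k : Type*) [Field k] [CharZero k] [IsAlgClosed k]

/-- **JOINT CONSISTENCY ON `ℚ(i)` AT `(3)`, STRUCTURES SUPPLIED**: `joint_four_three` with the number-field and
CM-field structures of `ℚ(ζ₄)` supplied inside the statement (`numberField L`, `isCMField_four L`) — no hypothesis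
on `L` beyond `IsCyclotomicExtension {4} ℚ L`. -/
theorem joint_four_three_concrete :
      haveI := numberField L; haveI := isCMField_four L
      ((∃ ψ : AddChar ((T5InertPrimeToy.vThree).adicCompletion ℚ) Circle, Continuous ψ ∧ (∃ y, ψ y ≠ 1) ∧
        conductorExp ψ (Valued.v : Valuation ((T5InertPrimeToy.vThree).adicCompletion ℚ) (WithZero (Multiplicative ℤ))) = 0 ∧
        conductorExp (ψ.compAddMonoidHom
          (Algebra.trace ((T5InertPrimeToy.vThree).adicCompletion ℚ) ((vThreePlus L).adicCompletion (maximalRealSubfield L))).toAddMonoidHom)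
          (Valued.v : Valuation ((vThreePlus L).adicCompletion (maximalRealSubfield L)) (WithZero (Multiplicative ℤ))) = 0) ∧
      ∀ (ψ : AddChar ((T5InertPrimeToy.vThree).adicCompletion ℚ) Circle), Continuous ψ → (∃ y, ψ y ≠ 1) →
        conductorExp ψ (Valued.v : Valuation ((T5InertPrimeToy.vThree).adicCompletion ℚ) (WithZero (Multiplicative ℤ))) = 0 →
        ∀ (w : HeightOneSpectrum (𝓞 L)) [w.asIdeal.LiesOver (vThreePlus L).asIdeal],
          (vThreePlus L).asIdeal.ramificationIdx' w.asIdeal = 1 ∧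
          conductorExp (recordChar L (T5InertPrimeToy.vThree) (vThreePlus L) w ψ)
            (Valued.v : Valuation (w.adicCompletion L) (WithZero (Multiplicative ℤ))) = 0 ∧
          (∀ x : w.adicCompletion L,
            (∀ y : w.adicCompletion L, Valued.v y ≤ 1 → recordChar L (T5InertPrimeToy.vThree) (vThreePlus L) w ψ (x * y) = 1) ↔ Valued.v x ≤ 1) ∧
          (∀ [StarRing (w.adicCompletion L)],
            (∀ z : w.adicCompletion L, IsLocalization.IsInteger (w.adicCompletionIntegers L) z →
              IsLocalization.IsInteger (w.adicCompletionIntegers L) (star z)) →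
            ∀ x : Fin 3 → w.adicCompletion L,
              (∀ y ∈ stdLattice (w.adicCompletionIntegers L),
                recordChar L (T5InertPrimeToy.vThree) (vThreePlus L) w ψ
                  (sesqForm (((algebraMap (𝓞 L) L).mapMatrix (Matrix.diagonal ![1, 1, -1])).map (algebraMap L (w.adicCompletion L))) x y) = 1) ↔
                x ∈ stdLattice (w.adicCompletionIntegers L)) ∧
          (letI := swapStarRing (w.adicCompletion L)
            ∀ x : Fin 3 → w.adicCompletion L × w.adicCompletion L,
              (∀ y : Fin 3 → w.adicCompletion L × w.adicCompletion L,
                (∀ i, Valued.v (y i).1 ≤ 1 ∧ Valued.v (y i).2 ≤ 1) →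
                recordChar L (T5InertPrimeToy.vThree) (vThreePlus L) w ψ
                    (sesqForm (pairMatrix (((algebraMap (𝓞 L) L).mapMatrix (Matrix.diagonal ![1, 1, -1])).map (algebraMap L (w.adicCompletion L)))
                      (((algebraMap (𝓞 L) L).mapMatrix (Matrix.diagonal ![1, 1, -1])).map (algebraMap L (w.adicCompletion L)))ᵀ) x y).1 *
                  recordChar L (T5InertPrimeToy.vThree) (vThreePlus L) w ψ
                    (sesqForm (pairMatrix (((algebraMap (𝓞 L) L).mapMatrix (Matrix.diagonal ![1, 1, -1])).map (algebraMap L (w.adicCompletion L)))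
                      (((algebraMap (𝓞 L) L).mapMatrix (Matrix.diagonal ![1, 1, -1])).map (algebraMap L (w.adicCompletion L)))ᵀ) x y).2 = 1) ↔
                ∀ i, Valued.v (x i).1 ≤ 1 ∧ Valued.v (x i).2 ≤ 1)) ∧
      (∃ (r : ℕ) (l : Fin r → 𝓞 L), Submodule.span (𝓞 (maximalRealSubfield L)) (Set.range l) = ⊤ ∧
        (letI := tensorStarRing L (vThreePlus L)
        letI := starRingOfQuadratic (finrank_eq_two L (vThreePlus L) (T5InertPrimeToy.wThree L) (neg_one_eq_zeta_sq L) (complexConj_zeta_ne L)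
            (not_isSquare_of_staysPrime L (vThreePlus L) (T5InertPrimeToy.wThree L) (neg_one_eq_zeta_sq L) (complexConj_zeta_ne L) (map_vThreePlus L)))
          (localConj (vThreePlus L) (T5InertPrimeToy.wThree L) (neg_one_eq_zeta_sq L).symm (span_pair_eq_top L (complexConj_zeta_ne L))
            (not_isSquare_of_staysPrime L (vThreePlus L) (T5InertPrimeToy.wThree L) (neg_one_eq_zeta_sq L) (complexConj_zeta_ne L) (map_vThreePlus L))
            (complexConj L))
          (localConj_ne_one (vThreePlus L) (T5InertPrimeToy.wThree L) (neg_one_eq_zeta_sq L).symm (span_pair_eq_top L (complexConj_zeta_ne L))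
            (not_isSquare_of_staysPrime L (vThreePlus L) (T5InertPrimeToy.wThree L) (neg_one_eq_zeta_sq L) (complexConj_zeta_ne L) (map_vThreePlus L))
            (complexConj L) (complexConj_apply_eq_neg L (neg_one_eq_zeta_sq L) (complexConj_zeta_ne L)))
        haveI := isDiscreteValuationRing_integralClosure_adicCompletion (vThreePlus L) (T5InertPrimeToy.wThree L)
        haveI := finite_residueField_integralClosure_adicCompletion (vThreePlus L) (T5InertPrimeToy.wThree L)
        haveI : IsFractionRing (integralClosure ((vThreePlus L).adicCompletionIntegers (maximalRealSubfield L))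
            ((T5InertPrimeToy.wThree L).adicCompletion L)) ((T5InertPrimeToy.wThree L).adicCompletion L) :=
          integralClosure.isFractionRing_of_finite_extension ((vThreePlus L).adicCompletion (maximalRealSubfield L))
            ((T5InertPrimeToy.wThree L).adicCompletion L)
        ∃ (u₀ : ((vThreePlus L).adicCompletionIntegers (maximalRealSubfield L))ˣ)
          (Φ : ↥(formUnitaryGroup (J3 (algebraMap ((vThreePlus L).adicCompletionIntegers (maximalRealSubfield L))
            ((T5InertPrimeToy.wThree L).adicCompletion L)
            (u₀ : (vThreePlus L).adicCompletionIntegers (maximalRealSubfield L))))) ≃*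
            ↥(formUnitaryGroup (tensorGram L (vThreePlus L) (gramToy L))))
          (ϖ' : integralClosure ((vThreePlus L).adicCompletionIntegers (maximalRealSubfield L))
            ((T5InertPrimeToy.wThree L).adicCompletion L))
          (hϖ' : Irreducible ϖ')
          (hs' : star (algebraMap (integralClosure ((vThreePlus L).adicCompletionIntegers (maximalRealSubfield L))
            ((T5InertPrimeToy.wThree L).adicCompletion L)) ((T5InertPrimeToy.wThree L).adicCompletion L) ϖ') =
              algebraMap (integralClosure ((vThreePlus L).adicCompletionIntegers (maximalRealSubfield L))
                ((T5InertPrimeToy.wThree L).adicCompletion L)) ((T5InertPrimeToy.wThree L).adicCompletion L) ϖ'),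
          (∀ g, g ∈ hyperspecialSubgroup
              (integralClosure ((vThreePlus L).adicCompletionIntegers (maximalRealSubfield L))
                ((T5InertPrimeToy.wThree L).adicCompletion L))
              (J3 (algebraMap ((vThreePlus L).adicCompletionIntegers (maximalRealSubfield L))
                ((T5InertPrimeToy.wThree L).adicCompletion L)
                (u₀ : (vThreePlus L).adicCompletionIntegers (maximalRealSubfield L)))) ↔
              Φ g ∈ recordHyperspecial L (vThreePlus L) l (gramToy L)) ∧
          ∀ {V : Type uV} [AddCommGroup V] [Module k V]
            (ρ : Representation k (↥(formUnitaryGroup (tensorGram L (vThreePlus L) (gramToy L)))) V) [ρ.IsIrreducible],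
            KFinite ρ (recordHyperspecial L (vThreePlus L) l (gramToy L)) →
            ∀ [FiniteDimensional k (invariants ρ (recordHyperspecial L (vThreePlus L) l (gramToy L)))],
            invariants ρ (recordHyperspecial L (vThreePlus L) l (gramToy L)) ≠ ⊥ →
            ∃ α : k, α ≠ 0 ∧ Nonempty (ρ.Equiv (comp Φ.symm
              (inertSphericalQuot
                (hstar_of_star_eq (localConj (vThreePlus L) (T5InertPrimeToy.wThree L) (neg_one_eq_zeta_sq L).symm (span_pair_eq_top L (complexConj_zeta_ne L))
                  (not_isSquare_of_staysPrime L (vThreePlus L) (T5InertPrimeToy.wThree L) (neg_one_eq_zeta_sq L) (complexConj_zeta_ne L) (map_vThreePlus L))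
                  (complexConj L))
                  (fun x => by
                    rw [star_p8_eq_star L (vThreePlus L) (T5InertPrimeToy.wThree L) (neg_one_eq_zeta_sq L) (complexConj_zeta_ne L)
                      (not_isSquare_of_staysPrime L (vThreePlus L) (T5InertPrimeToy.wThree L) (neg_one_eq_zeta_sq L) (complexConj_zeta_ne L)
                        (map_vThreePlus L))]
                    rfl))
                (algebraMap ((vThreePlus L).adicCompletionIntegers (maximalRealSubfield L))
                  ((T5InertPrimeToy.wThree L).adicCompletion L)
                  (u₀ : (vThreePlus L).adicCompletionIntegers (maximalRealSubfield L)))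
                (star_algebraMap_of_star_eq (localConj (vThreePlus L) (T5InertPrimeToy.wThree L) (neg_one_eq_zeta_sq L).symm
                  (span_pair_eq_top L (complexConj_zeta_ne L))
                  (not_isSquare_of_staysPrime L (vThreePlus L) (T5InertPrimeToy.wThree L) (neg_one_eq_zeta_sq L) (complexConj_zeta_ne L) (map_vThreePlus L))
                  (complexConj L))
                  (fun x => by
                    rw [star_p8_eq_star L (vThreePlus L) (T5InertPrimeToy.wThree L) (neg_one_eq_zeta_sq L) (complexConj_zeta_ne L)
                      (not_isSquare_of_staysPrime L (vThreePlus L) (T5InertPrimeToy.wThree L) (neg_one_eq_zeta_sq L) (complexConj_zeta_ne L)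
                        (map_vThreePlus L))]
                    rfl)
                  (u₀ : (vThreePlus L).adicCompletionIntegers (maximalRealSubfield L)))
                (algebraMap_unit_ne_zero (F := (vThreePlus L).adicCompletion (maximalRealSubfield L)) u₀)
                (isInteger_algebraMap (u₀ : (vThreePlus L).adicCompletionIntegers (maximalRealSubfield L)))
                (isInteger_algebraMap_unit_inv u₀) hϖ' hs' k (α * ((3 : k) ^ 2)⁻¹)))))) :=
  @joint_four_three L _ _ _ (numberField L) (isCMField_four L) k _ _ _

end Concrete

end Summit.Ventures.HodgeRepro2.T5RecordFourThreeJoint
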